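import Literature.Analysis.Complex.OpensFlat
import Literature.Analysis.Calculus.CylinderHomotopyPullback
import Mathlib.Geometry.Manifold.ContMDiff.NormedSpace
import Mathlib.Geometry.Manifold.MFDeriv.FDeriv
import Mathlib.Analysis.Calculus.MeanValue
import HarnessLib

/-!
# Smooth homotopy invariance of de Rham cohomology for open submanifolds of normed spaces (Lee, Prop. 17.10)

Topic `NumberTheory/Transcendental` (trunk TranscendKaehlerL, de Rham theory of `DeRhamTheorem.lean`).
Definitions with bodies and theorems; no named fact, no `sorry`.

`Literature.Geometry.Kaehler.deRhamCohomology.map_eq_of_homotopic I M I' N F`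
(`DeRhamTheorem.lean`) is the named fact (D-0014): smoothly homotopic maps `f, g : M → N` induce the
same map `f^* = g^*` on de Rham cohomology (Lee, *Introduction to Smooth Manifolds* (2012),
Prop. 17.10; Bott–Tu (1982), Cor. 4.1.2), for arbitrary `C^∞` manifolds with corners.  This file
PROVES it for open submanifolds of real normed spaces — `M = ↥U`, `N = ↥V` for `U ⊆ E`, `V ⊆ E'`
open, with Mathlib's open-submanifold structures and the models `𝓘(ℝ, E)`, `𝓘(ℝ, E')`, `E`, `E'`
ARBITRARY real normed spaces, coefficients in a complete space `F` — following the printed proof: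
Lemma 17.9 (the cylinder homotopy operator `h` with `h(dω) + d(hω) = i₁^* ω - i₀^* ω`,
`Literature/Analysis/Calculus/CylinderHomotopyOperator.lean`) applied to `ω = Φ^* β`
(`CylinderHomotopyPullback.lean`), read on `↥U` through the dictionary
`Literature/Analysis/Complex/OpensFlat.lean` (`flatExt`, `restrictOpens`) exactly as the Poincaré
lemma `ExactSmoothFormsEqClosedSmoothFormsOfConvex_holds` (`PoincareLemmaConvexProofs.lean`):

* `flatMap φ`, `flatHomotopy Φ` — the flat extensions (by `0`) to `E`, `E × ℝ` of a map `φ : U → V`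
  and of a homotopy `Φ : ℝ × U → V`; `contDiffOn_flatMap`, `contDiffOn_flatHomotopy` — they are
  `C^∞` on `U`, `U × ℝ` when `φ`, `Φ` are `C^∞` in the manifold sense (Mathlib's
  `contMDiffAt_subtype_iff`, `ContMDiff.subtypeVal_comp_iff`, `contMDiffAt_iff_contDiffAt`);
* `mfderiv_eq_fderiv_flatMap` — `mfderiv 𝓘(ℝ, E) 𝓘(ℝ, E') φ x = D(flatMap φ)(x)` (the inclusions
  of open submanifolds have identity differential, `OpenSubmanifold.hasMFDerivAt_subtype_val`);
  `flatExt_pullback` — the flat extension of `φ^* β` is the normed-space pull-back of `flatExt β`;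
* `pullback_eq_of_homotopic_zero` — in degree `0`, `f^* β = g^* β` for a closed `0`-form
  (`dβ = 0` forces `Dβ = 0`, so `β` is constant along `t ↦ Φ(t, x)`);
* **`deRhamCohomology.map_eq_of_homotopic_opens`** — `f^* = g^*` on `H^k_dR(V; F) → H^k_dR(U; F)`
  for `f, g : U → V` joined by a `C^∞` homotopy `Φ : ℝ × U → V` (`Φ(0, ·) = f`, `Φ(1, ·) = g`),
  all degrees `k`; the pull-back calculus instance is the tree's global `instPullbackFacts`.

[cite: Lee2012, Ch. 17, Prop. 17.10 (proof) with Lemma 17.9] [cite: BottTu1982Forms, §I.4 Cor. 4.1.2]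

## References

* J. M. Lee, *Introduction to Smooth Manifolds*, 2nd ed., GTM 218, Springer (2012), Ch. 17,
  Lemma 17.9, Prop. 17.10. [Lee2012]
* R. Bott, L. W. Tu, *Differential Forms in Algebraic Topology*, GTM 82 (1982), §I.4,
  Cor. 4.1.2. [BottTu1982Forms]
-/

noncomputable section

open scoped Manifold ContDiff Topology
open Set Function Literature.Geometry.Kaehler Literature.Analysis.Complex Literature.Analysis.Calculus

namespace Literature.NumberTheory.Transcendental

universe u v w

variable {E : Type u} [NormedAddCommGroup E] [NormedSpace ℝ E]
  {E' : Type w} [NormedAddCommGroup E'] [NormedSpace ℝ E']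
  {F : Type v} [NormedAddCommGroup F] [NormedSpace ℝ F]

/-! ### Maps between open submanifolds of normed spaces, read as flat maps -/

section FlatMap

variable {U : TopologicalSpace.Opens E} {V : TopologicalSpace.Opens E'}

open Classical in
/-- The **flat extension** of a map `φ : U → V` between open subsets of normed spaces: `↑(φ x)` on
`U`, `0` off `U`. [cite: Lee2012, Ch. 17, Prop. 17.10 (proof)] -/
def flatMap (φ : U → V) : E → E' := fun y =>
  if hy : y ∈ U then ((φ ⟨y, hy⟩ : V) : E') else 0

omit [NormedSpace ℝ E] [NormedSpace ℝ E'] in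
/-- On `U` the flat extension is the map. [cite: Lee2012, Ch. 17, Prop. 17.10 (proof)] -/
@[simp]
theorem flatMap_coe (φ : U → V) (x : U) : flatMap φ x = ((φ x : V) : E') := by
  unfold flatMap
  rw [dif_pos x.2]

omit [NormedSpace ℝ E] [NormedSpace ℝ E'] in
/-- The flat extension maps `U` into `V`. [cite: Lee2012, Ch. 17, Prop. 17.10 (proof)] -/
theorem flatMap_mem (φ : U → V) {y : E} (hy : y ∈ (U : Set E)) : flatMap φ y ∈ (V : Set E') := by
  rw [show y = ((⟨y, hy⟩ : U) : E) from rfl, flatMap_coe]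
  exact (φ ⟨y, hy⟩).2

/-- **A `C^∞` map of open submanifolds is `C^∞` as a flat map**, at every point of `U`: the charts
of `↥U`, `↥V` are the inclusions (Mathlib's `contMDiffAt_subtype_iff`,
`ContMDiffAt.subtypeVal_comp_iff`, `contMDiffAt_iff_contDiffAt`). [cite: Lee2012, Ch. 17, Prop. 17.10 (proof)] -/
theorem contDiffAt_flatMap {φ : U → V} (hφ : ContMDiff 𝓘(ℝ, E) 𝓘(ℝ, E') ∞ φ) (x : U) :
    ContDiffAt ℝ ∞ (flatMap φ) (x : E) := by
  have h1 : ContMDiffAt 𝓘(ℝ, E) 𝓘(ℝ, E') ∞ (Subtype.val ∘ φ) x :=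
    (ContMDiffAt.subtypeVal_comp_iff V φ x).2 (hφ x)
  have h2 : (fun y : U => flatMap φ (y : E)) = Subtype.val ∘ φ := by
    funext y
    exact flatMap_coe φ y
  have h3 : ContMDiffAt 𝓘(ℝ, E) 𝓘(ℝ, E') ∞ (fun y : U => flatMap φ (y : E)) x := by
    rw [h2]
    exact h1
  exact contMDiffAt_iff_contDiffAt.1 (contMDiffAt_subtype_iff.1 h3)

/-- The flat extension of a `C^∞` map of open submanifolds is `C^∞` on `U`.
[cite: Lee2012, Ch. 17, Prop. 17.10 (proof)] -/
theorem contDiffOn_flatMap {φ : U → V} (hφ : ContMDiff 𝓘(ℝ, E) 𝓘(ℝ, E') ∞ φ) :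
    ContDiffOn ℝ ∞ (flatMap φ) U := fun y hy =>
  (contDiffAt_flatMap hφ ⟨y, hy⟩).contDiffWithinAt

/-- **`mfderiv` of a map of open submanifolds is the derivative of its flat extension** (the
inclusions `↥U → E`, `↥V → E'` have identity differential, and `val ∘ φ = flatMap φ ∘ val`).
[cite: Lee2012, Ch. 17, Prop. 17.10 (proof)] -/
theorem mfderiv_eq_fderiv_flatMap {φ : U → V} (hφ : ContMDiff 𝓘(ℝ, E) 𝓘(ℝ, E') ∞ φ) (x : U) :
    (mfderiv 𝓘(ℝ, E) 𝓘(ℝ, E') φ x : E →L[ℝ] E') = fderiv ℝ (flatMap φ) (x : E) := by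
  have hφd : MDifferentiableAt 𝓘(ℝ, E) 𝓘(ℝ, E') φ x := hφ.mdifferentiableAt (by simp)
  -- `val ∘ φ` has differential `id ∘ mfderiv φ x`
  have hA : HasMFDerivAt 𝓘(ℝ, E) 𝓘(ℝ, E') (Subtype.val ∘ φ) x
      ((ContinuousLinearMap.id ℝ E').comp (mfderiv 𝓘(ℝ, E) 𝓘(ℝ, E') φ x)) :=
    (Literature.Geometry.Manifold.OpenSubmanifold.hasMFDerivAt_subtype_val (I := 𝓘(ℝ, E'))
      (φ x)).comp x hφd.hasMFDerivAt
  -- `flatMap φ ∘ val = val ∘ φ` has differential `D(flatMap φ)(x) ∘ id`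
  have hB₀ : HasMFDerivAt 𝓘(ℝ, E) 𝓘(ℝ, E') (flatMap φ ∘ Subtype.val) x
      ((fderiv ℝ (flatMap φ) (x : E)).comp (ContinuousLinearMap.id ℝ E)) := by
    have h1 := ((contDiffAt_flatMap hφ x).differentiableAt (by simp)).hasFDerivAt.hasMFDerivAt
    exact h1.comp x (Literature.Geometry.Manifold.OpenSubmanifold.hasMFDerivAt_subtype_val
      (I := 𝓘(ℝ, E)) x)
  have hAB : (Subtype.val ∘ φ : U → E') = flatMap φ ∘ Subtype.val :=
    funext fun y => (flatMap_coe φ y).symm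
  have hB : HasMFDerivAt 𝓘(ℝ, E) 𝓘(ℝ, E') (Subtype.val ∘ φ) x
      ((fderiv ℝ (flatMap φ) (x : E)).comp (ContinuousLinearMap.id ℝ E)) :=
    hB₀.congr_of_eventuallyEq (Filter.EventuallyEq.of_eq hAB)
  have h := hasMFDerivAt_unique hA hB
  ext v
  exact congrArg (fun T => T v) h

/-- **The flat extension of a pulled-back form is the flat pull-back**: for `φ : U → V` smooth, a
form `β` on `↥V` and `x ∈ U`,
`flatExt (φ^* β) x = (flatExt β (flatMap φ x)) ∘ D(flatMap φ)(x)`. [cite: Lee2012, Ch. 17, Prop. 17.10 (proof)] -/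
theorem flatExt_pullback {k : ℕ} {φ : U → V} (hφ : ContMDiff 𝓘(ℝ, E) 𝓘(ℝ, E') ∞ φ)
    (β : MForm 𝓘(ℝ, E') V F k) (x : U) :
    flatExt (β.pullback 𝓘(ℝ, E) φ) x =
      (flatExt β (flatMap φ x)).compContinuousLinearMap (fderiv ℝ (flatMap φ) (x : E)) := by
  rw [flatExt_coe, flatMap_coe, flatExt_coe, ← mfderiv_eq_fderiv_flatMap hφ x]
  rfl

end FlatMap

/-! ### Homotopies `ℝ × U → V`, read as flat maps on the cylinder `E × ℝ` -/

section FlatHomotopy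

variable {U : TopologicalSpace.Opens E} {V : TopologicalSpace.Opens E'}

open Classical in
/-- The **flat homotopy** of `Φ : ℝ × U → V` on the cylinder `E × ℝ` (parameter last, the
convention of `CylinderHomotopyOperator.lean`): `↑(Φ (t, x))` at `(x, t)` for `x ∈ U`, `0` off
`U × ℝ`. [cite: Lee2012, Ch. 17, Prop. 17.10 (proof)] -/
def flatHomotopy (Φ : ℝ × U → V) : E × ℝ → E' := fun p =>
  if hy : p.1 ∈ U then ((Φ (p.2, ⟨p.1, hy⟩) : V) : E') else 0

omit [NormedSpace ℝ E] [NormedSpace ℝ E'] in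
/-- On `U × ℝ` the flat homotopy is the homotopy. [cite: Lee2012, Ch. 17, Prop. 17.10 (proof)] -/
@[simp]
theorem flatHomotopy_coe (Φ : ℝ × U → V) (x : U) (t : ℝ) :
    flatHomotopy Φ ((x : E), t) = ((Φ (t, x) : V) : E') := by
  unfold flatHomotopy
  rw [dif_pos x.2]

omit [NormedSpace ℝ E] [NormedSpace ℝ E'] in
/-- The flat homotopy maps `U × ℝ` into `V`. [cite: Lee2012, Ch. 17, Prop. 17.10 (proof)] -/
theorem mapsTo_flatHomotopy (Φ : ℝ × U → V) :
    MapsTo (flatHomotopy Φ) ((U : Set E) ×ˢ (univ : Set ℝ)) V := by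
  rintro ⟨y, t⟩ ⟨hy, -⟩
  rw [show ((y, t) : E × ℝ) = (((⟨y, hy⟩ : U) : E), t) from rfl, flatHomotopy_coe]
  exact (Φ (t, ⟨y, hy⟩)).2

omit [NormedSpace ℝ E] [NormedSpace ℝ E'] in
/-- The slices of the flat homotopy are the flat extensions of the slices of `Φ`.
[cite: Lee2012, Ch. 17, Prop. 17.10 (proof)] -/
theorem flatMap_slice (Φ : ℝ × U → V) (t : ℝ) :
    flatMap (fun x : U => Φ (t, x)) = fun y : E => flatHomotopy Φ (y, t) := by
  funext y
  by_cases hy : y ∈ U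
  · rw [show y = ((⟨y, hy⟩ : U) : E) from rfl, flatMap_coe, flatHomotopy_coe]
  · simp only [flatMap, flatHomotopy, dif_neg hy]

/-- **A `C^∞` homotopy `ℝ × U → V` is `C^∞` as a flat map on `U × ℝ`.**  The open set `U × ℝ` of
`E × ℝ` is read as the open submanifold `↥W`; the map `w ↦ (t, ⟨y, _⟩) : ↥W → ℝ × ↥U` is `C^∞`
(its components are), so `val ∘ Φ ∘ (·)` is `C^∞` on `↥W`, and the charts of `↥W` are the
inclusion. [cite: Lee2012, Ch. 17, Prop. 17.10 (proof)] -/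
theorem contDiffOn_flatHomotopy {Φ : ℝ × U → V}
    (hΦ : ContMDiff (𝓘(ℝ, ℝ).prod 𝓘(ℝ, E)) 𝓘(ℝ, E') ∞ Φ) :
    ContDiffOn ℝ ∞ (flatHomotopy Φ) ((U : Set E) ×ˢ (univ : Set ℝ)) := by
  -- the open submanifold `W = U × ℝ` of `E × ℝ`
  let W : TopologicalSpace.Opens (E × ℝ) := ⟨(U : Set E) ×ˢ (univ : Set ℝ), U.isOpen.prod isOpen_univ⟩
  -- the map `θ : W → ℝ × U`, `θ (y, t) = (t, ⟨y, _⟩)`, and its smoothness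
  let θ : W → ℝ × U := fun w => ((w : E × ℝ).2, ⟨(w : E × ℝ).1, w.2.1⟩)
  have hval : ContMDiff 𝓘(ℝ, E × ℝ) 𝓘(ℝ, E × ℝ) ∞ (Subtype.val : W → E × ℝ) :=
    contMDiff_subtype_val
  have hθ₁ : ContMDiff 𝓘(ℝ, E × ℝ) 𝓘(ℝ, ℝ) ∞ (fun w : W => (w : E × ℝ).2) :=
    (contMDiff_iff_contDiff.2 contDiff_snd).comp hval
  have hθ₂' : ContMDiff 𝓘(ℝ, E × ℝ) 𝓘(ℝ, E) ∞
      (Subtype.val ∘ fun w : W => (⟨(w : E × ℝ).1, w.2.1⟩ : U)) :=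
    (contMDiff_iff_contDiff.2 contDiff_fst).comp hval
  have hθ₂ : ContMDiff 𝓘(ℝ, E × ℝ) 𝓘(ℝ, E) ∞ (fun w : W => (⟨(w : E × ℝ).1, w.2.1⟩ : U)) :=
    (ContMDiff.subtypeVal_comp_iff U _).1 hθ₂'
  have hθ : ContMDiff 𝓘(ℝ, E × ℝ) (𝓘(ℝ, ℝ).prod 𝓘(ℝ, E)) ∞ θ := hθ₁.prodMk hθ₂
  -- `val ∘ Φ ∘ θ` is `C^∞` on `↥W` and is the restriction of the flat homotopy
  have hcomp : ContMDiff 𝓘(ℝ, E × ℝ) 𝓘(ℝ, E') ∞ (Subtype.val ∘ Φ ∘ θ) :=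
    ((ContMDiff.subtypeVal_comp_iff V Φ).2 hΦ).comp hθ
  have heq : (fun w : W => flatHomotopy Φ (w : E × ℝ)) = Subtype.val ∘ Φ ∘ θ := by
    funext w
    obtain ⟨⟨y, t⟩, hy, -⟩ := w
    change flatHomotopy Φ (y, t) = ((Φ (t, ⟨y, hy⟩) : V) : E')
    rw [show ((y, t) : E × ℝ) = (((⟨y, hy⟩ : U) : E), t) from rfl, flatHomotopy_coe]
  -- read in the charts of `↥W` (the inclusion)
  rintro ⟨y, t⟩ hp
  have hw : ContMDiffAt 𝓘(ℝ, E × ℝ) 𝓘(ℝ, E') ∞ (fun w : W => flatHomotopy Φ (w : E × ℝ))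
      (⟨(y, t), hp⟩ : W) := by
    rw [heq]
    exact hcomp _
  exact (contMDiffAt_iff_contDiffAt.1 (contMDiffAt_subtype_iff.1 hw)).contDiffWithinAt

end FlatHomotopy

/-! ### Degree zero: a closed `0`-form is constant along the homotopy -/

section DegreeZero

variable {U : TopologicalSpace.Opens E} {V : TopologicalSpace.Opens E'}

/-- For a `0`-form, `dβ = 0` at a point of differentiability forces `Dβ = 0` there (Mathlib's
normalisation `dβ(y)(u) = Dβ(y)(u)()`, first slot separated: `extDeriv_apply_vecCons`).
[cite: Lee2012, Ch. 17, Prop. 17.6 (proof)] -/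
theorem fderiv_eq_zero_of_extDeriv_eq_zero {β : E' → E' [⋀^Fin 0]→L[ℝ] F} {y : E'}
    (hd : extDeriv β y = 0) : fderiv ℝ β y = 0 := by
  ext u w
  have h := congrArg (fun T : E' [⋀^Fin 1]→L[ℝ] F => T (Matrix.vecCons u w)) hd
  simp only [extDeriv, ContinuousAlternatingMap.alternatizeUncurryFin_apply, Fin.sum_univ_succ,
    Fin.sum_univ_zero, add_zero, Fin.val_zero, pow_zero, one_smul, Matrix.cons_val_zero] at h
  rw [show w = Fin.removeNth 0 (Matrix.vecCons u w) from funext fun i => Fin.elim0 i, h]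
  rfl

/-- **In degree `0`, homotopic maps pull a closed form back to the SAME form**: a closed smooth
`0`-form `β` on `↥V` is constant along each path `t ↦ Φ(t, x)`, so `f^* β = g^* β`
(Lee, Prop. 17.10 with Prop. 17.6: `H⁰` is the locally constant functions).
[cite: Lee2012, Ch. 17, Prop. 17.10 (proof)] -/
theorem pullback_eq_of_homotopic_zero {f g : U → V} {Φ : ℝ × U → V}
    (hΦ : ContMDiff (𝓘(ℝ, ℝ).prod 𝓘(ℝ, E)) 𝓘(ℝ, E') ∞ Φ) (h₀ : ∀ x, Φ (0, x) = f x)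
    (h₁ : ∀ x, Φ (1, x) = g x) {β : MForm 𝓘(ℝ, E') V F 0}
    (hβ : β ∈ closedSmoothForms 𝓘(ℝ, E') V F 0) :
    β.pullback 𝓘(ℝ, E) f = β.pullback 𝓘(ℝ, E) g := by
  have hβs : ContDiffOn ℝ ∞ (flatExt β) V := (isSmoothForm_iff_contDiffOn_flatExt β).1 hβ.1
  have hβd : ∀ z ∈ (V : Set E'), extDeriv (flatExt β) z = 0 := by
    intro z hz
    rw [← flatExt_mextDeriv_of_mem β hz, show mextDeriv β = 0 from hβ.2,
      ← show (((⟨z, hz⟩ : V) : V) : E') = z from rfl, flatExt_coe]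
    rfl
  have hΦs := contDiffOn_flatHomotopy hΦ
  funext x
  -- the curve `t ↦ flatExt β (Φ(t, x))` has zero derivative, hence is constant
  have hγ : ∀ t : ℝ, DifferentiableAt ℝ (fun s : ℝ => flatHomotopy Φ ((x : E), s)) t := by
    intro t
    have h1 : ContDiffAt ℝ ∞ (flatHomotopy Φ) ((x : E), t) :=
      (hΦs _ ⟨x.2, mem_univ _⟩).contDiffAt ((U.isOpen.prod isOpen_univ).mem_nhds ⟨x.2, mem_univ _⟩)
    exact (h1.differentiableAt (by simp)).comp t
      ((differentiableAt_const _).prodMk differentiableAt_id)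
  have hmem : ∀ t : ℝ, flatHomotopy Φ ((x : E), t) ∈ (V : Set E') := fun t =>
    mapsTo_flatHomotopy Φ ⟨x.2, mem_univ t⟩
  have hβdiff : ∀ t : ℝ, DifferentiableAt ℝ (flatExt β) (flatHomotopy Φ ((x : E), t)) := fun t =>
    ((hβs _ (hmem t)).contDiffAt (V.isOpen.mem_nhds (hmem t))).differentiableAt (by simp)
  have hcd : Differentiable ℝ (fun t : ℝ => flatExt β (flatHomotopy Φ ((x : E), t))) := fun t => by
    have h := (hβdiff t).comp t (hγ t)
    exact h
  have hc0 : ∀ t, deriv (fun t : ℝ => flatExt β (flatHomotopy Φ ((x : E), t))) t = 0 := by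
    intro t
    have h1' := (hβdiff t).hasFDerivAt.comp_hasDerivAt t (hγ t).hasDerivAt
    have h1 : HasDerivAt (fun s : ℝ => flatExt β (flatHomotopy Φ ((x : E), s)))
        (fderiv ℝ (flatExt β) (flatHomotopy Φ ((x : E), t))
          (deriv (fun s : ℝ => flatHomotopy Φ ((x : E), s)) t)) t := h1'
    rw [h1.deriv, fderiv_eq_zero_of_extDeriv_eq_zero (hβd _ (hmem t))]
    rfl
  have hconst := is_const_of_deriv_eq_zero hcd hc0 0 1
  rw [flatHomotopy_coe, flatHomotopy_coe, h₀, h₁, flatExt_coe, flatExt_coe] at hconst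
  -- evaluate both pull-backs: a `0`-form sees no vector
  apply ContinuousAlternatingMap.ext
  intro v
  rw [MForm.pullback_apply, MForm.pullback_apply,
    show (fun i => mfderiv 𝓘(ℝ, E) 𝓘(ℝ, E') f x (v i)) =
      (fun i => mfderiv 𝓘(ℝ, E) 𝓘(ℝ, E') g x (v i)) from funext fun i => Fin.elim0 i]
  exact congrArg (fun T : E' [⋀^Fin 0]→L[ℝ] F => T fun i => mfderiv 𝓘(ℝ, E) 𝓘(ℝ, E') g x (v i))
    hconst

end DegreeZero

/-! ### The theorem -/

section Main

variable [CompleteSpace F]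

/-- **Smooth homotopy invariance of de Rham cohomology, for open submanifolds of normed spaces**
(Lee, Prop. 17.10; Bott–Tu, Cor. 4.1.2): if `f, g : U → V` (`U ⊆ E`, `V ⊆ E'` open, `E`, `E'` real
normed spaces) are `C^∞` and joined by a `C^∞` homotopy `Φ : ℝ × U → V` (`C^∞` for
`𝓘(ℝ, ℝ).prod 𝓘(ℝ, E)`, `Φ(0, ·) = f`, `Φ(1, ·) = g`), then `f^* = g^*` on `H^k_dR(V; F)` for every
`k` (coefficients in a complete `F`).  Proof as printed: in degree `k + 1`, for a closed `β`,
`g^* β - f^* β = d(h(Φ^* β))` with Lee's cylinder operator `h`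
(`exists_extDeriv_eq_pullbackForm_sub_pullbackForm`, read on `↥U` through `flatExt` /
`restrictOpens`); in degree `0`, `f^* β = g^* β` (`pullback_eq_of_homotopic_zero`).  This is the
named fact `deRhamCohomology.map_eq_of_homotopic` of `DeRhamTheorem.lean` for the manifolds `↥U`,
`↥V`. [cite: Lee2012, Ch. 17, Prop. 17.10] [cite: BottTu1982Forms, §I.4 Cor. 4.1.2] -/
theorem _root_.Literature.Geometry.Kaehler.deRhamCohomology.map_eq_of_homotopic_opens
    (U : TopologicalSpace.Opens E) (V : TopologicalSpace.Opens E') {f g : U → V}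
    (hf : ContMDiff 𝓘(ℝ, E) 𝓘(ℝ, E') ∞ f) (hg : ContMDiff 𝓘(ℝ, E) 𝓘(ℝ, E') ∞ g) (Φ : ℝ × U → V)
    (hΦ : ContMDiff (𝓘(ℝ, ℝ).prod 𝓘(ℝ, E)) 𝓘(ℝ, E') ∞ Φ) (h₀ : ∀ x, Φ (0, x) = f x)
    (h₁ : ∀ x, Φ (1, x) = g x) (k : ℕ) :
    (deRhamCohomology.map hf k :
        deRhamCohomology 𝓘(ℝ, E') V F k →ₗ[ℝ] deRhamCohomology 𝓘(ℝ, E) U F k) =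
      deRhamCohomology.map hg k := by
  cases k with
  | zero =>
    refine Submodule.linearMap_qext _ (LinearMap.ext fun β => ?_)
    change deRhamCohomology.map hf 0 (deRhamCohomology.mk β) =
      deRhamCohomology.map hg 0 (deRhamCohomology.mk β)
    rw [deRhamCohomology.map_mk, deRhamCohomology.map_mk, deRhamCohomology.mk_eq_mk_iff]
    change (β : MForm 𝓘(ℝ, E') V F 0).pullback 𝓘(ℝ, E) f -
      (β : MForm 𝓘(ℝ, E') V F 0).pullback 𝓘(ℝ, E) g ∈ exactSmoothForms 𝓘(ℝ, E) U F 0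
    rw [pullback_eq_of_homotopic_zero hΦ h₀ h₁ β.2, sub_self]
    exact zero_mem _
  | succ k =>
    refine Submodule.linearMap_qext _ (LinearMap.ext fun β => ?_)
    change deRhamCohomology.map hf (k + 1) (deRhamCohomology.mk β) =
      deRhamCohomology.map hg (k + 1) (deRhamCohomology.mk β)
    rw [deRhamCohomology.map_mk, deRhamCohomology.map_mk, deRhamCohomology.mk_eq_mk_iff]
    change (β : MForm 𝓘(ℝ, E') V F (k + 1)).pullback 𝓘(ℝ, E) f -
      (β : MForm 𝓘(ℝ, E') V F (k + 1)).pullback 𝓘(ℝ, E) g ∈ exactSmoothForms 𝓘(ℝ, E) U F (k + 1)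
    -- the flat data on the cylinder `U × ℝ ⊆ E × ℝ`
    have hΩ : IsOpen ((U : Set E) ×ˢ (univ : Set ℝ)) := U.isOpen.prod isOpen_univ
    have hΦs : ContDiffOn ℝ (⊤ : ℕ∞) (flatHomotopy Φ) ((U : Set E) ×ˢ (univ : Set ℝ)) :=
      contDiffOn_flatHomotopy hΦ
    have hβs : ContDiffOn ℝ (⊤ : ℕ∞) (flatExt (β : MForm 𝓘(ℝ, E') V F (k + 1))) V :=
      (isSmoothForm_iff_contDiffOn_flatExt _).1 β.2.1
    have hβd : ∀ z ∈ (V : Set E'), extDeriv (flatExt (β : MForm 𝓘(ℝ, E') V F (k + 1))) z = 0 := by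
      intro z hz
      rw [← flatExt_mextDeriv_of_mem _ hz, show mextDeriv (β : MForm 𝓘(ℝ, E') V F (k + 1)) = 0
        from β.2.2, ← show (((⟨z, hz⟩ : V) : V) : E') = z from rfl, flatExt_coe]
      rfl
    -- Lee's cylinder operator: `η = h(Φ^* β)` with `dη = Φ₁^* β - Φ₀^* β` on `U`
    obtain ⟨η, hηs, hηd⟩ := exists_extDeriv_eq_pullbackForm_sub_pullbackForm hΩ V.isOpen hΦs
      (mapsTo_flatHomotopy Φ) hβs hβd U.isOpen (prod_mono Subset.rfl (subset_univ _))
    -- back to the open submanifold `↥U`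
    have hfs : flatMap f = fun y : E => flatHomotopy Φ (y, 0) := by
      rw [← flatMap_slice Φ 0]
      exact congrArg flatMap (funext fun x => (h₀ x).symm)
    have hgs : flatMap g = fun y : E => flatHomotopy Φ (y, 1) := by
      rw [← flatMap_slice Φ 1]
      exact congrArg flatMap (funext fun x => (h₁ x).symm)
    have hδs : IsSmoothForm (restrictOpens U η) := isSmoothForm_restrictOpens hηs
    have hδd : mextDeriv (restrictOpens U η) =
        (β : MForm 𝓘(ℝ, E') V F (k + 1)).pullback 𝓘(ℝ, E) g -
          (β : MForm 𝓘(ℝ, E') V F (k + 1)).pullback 𝓘(ℝ, E) f := by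
      rw [mextDeriv_restrictOpens]
      funext x
      have e1 : (restrictOpens U (extDeriv η) x : E [⋀^Fin (k + 1)]→L[ℝ] F) = extDeriv η x :=
        restrictOpens_apply _ x
      have e2 := hηd x x.2
      have e3 : flatExt ((β : MForm 𝓘(ℝ, E') V F (k + 1)).pullback 𝓘(ℝ, E) g) x -
          flatExt ((β : MForm 𝓘(ℝ, E') V F (k + 1)).pullback 𝓘(ℝ, E) f) x =
          (flatExt (β : MForm 𝓘(ℝ, E') V F (k + 1)) (flatHomotopy Φ ((x : E), 1))).compContinuousLinearMap
              (fderiv ℝ (fun y : E => flatHomotopy Φ (y, 1)) x) -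
            (flatExt (β : MForm 𝓘(ℝ, E') V F (k + 1)) (flatHomotopy Φ ((x : E), 0))).compContinuousLinearMap
              (fderiv ℝ (fun y : E => flatHomotopy Φ (y, 0)) x) := by
        rw [flatExt_pullback hg, flatExt_pullback hf, hgs, hfs]
      have e4 : flatExt ((β : MForm 𝓘(ℝ, E') V F (k + 1)).pullback 𝓘(ℝ, E) g) x -
          flatExt ((β : MForm 𝓘(ℝ, E') V F (k + 1)).pullback 𝓘(ℝ, E) f) x =
          ((((β : MForm 𝓘(ℝ, E') V F (k + 1)).pullback 𝓘(ℝ, E) g -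
            (β : MForm 𝓘(ℝ, E') V F (k + 1)).pullback 𝓘(ℝ, E) f) x :) : E [⋀^Fin (k + 1)]→L[ℝ] F) := by
        rw [flatExt_coe, flatExt_coe]
        rfl
      apply ContinuousAlternatingMap.ext
      intro v
      exact congrArg (fun T : E [⋀^Fin (k + 1)]→L[ℝ] F => T v) (e1.trans (e2.trans (e3.symm.trans e4)))
    have hmem : (β : MForm 𝓘(ℝ, E') V F (k + 1)).pullback 𝓘(ℝ, E) g -
        (β : MForm 𝓘(ℝ, E') V F (k + 1)).pullback 𝓘(ℝ, E) f ∈ exactSmoothForms 𝓘(ℝ, E) U F (k + 1) :=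
      Submodule.subset_span ⟨restrictOpens U η, hδs, hδd⟩
    rw [← neg_sub]
    exact Submodule.neg_mem _ hmem

end Main

end Literature.NumberTheory.Transcendental

end
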